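import Summits.CriticalPhenomena.SAWScalingLimit.Theorems.SAWReversalUpgradeFaithfulOfNoReturnHalfPlane
import Summits.CriticalPhenomena.SAWScalingLimit.Theorems.SAWReversalUpgradeAttachReversalDefs
import Summits.CriticalPhenomena.SAWScalingLimit.Theorems.SAWReversalUpgradeAttachmentExistsSqueeze
import Mathlib.Analysis.SpecialFunctions.Trigonometric.Bounds
import HarnessLib

/-!
# Route `SAWReversalUpgrade`, support `FaithfulOfNoReturn` (stmt-CriticalPhenomena-18008):
# the squeezed boundary correspondence `T = Φ ∘ A_e ∘ ψ`

Helper file (2 of several) for the proof of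
`Summit.CriticalPhenomena.SAWScalingLimit.Theses.SAWReversalUpgrade.FaithfulOfNoReturn`.

The route's attachment pushes the SAW polyline off `∂D` by the *angular squeeze*
`A_e z = ‖z‖ · exp (i (e + (1 - 2e/π) arg z))` in uniformizing coordinates
(`AttachReversal.squeeze`, landed with `SAWReversalUpgradeAttachReversalDefs`; its elementary
properties `sqz_*` are the tree's `SAWReversalUpgradeAttachmentExistsSqueeze`). Here:

* `norm_squeeze_sub_le`: `‖A_e z - z‖ ≤ e ‖z‖` on the closed half-plane `H`;
* **uniform smallness** `exists_squeeze_close`: for every `κ > 0` there is `e₀ > 0` with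
  `dist (Φ (A_e z)) (Φ z) < κ` for all `z ∈ H`, `0 < e ≤ e₀` (`Φ = φ.boundaryExtension`;
  Carathéodory continuity on compacta + `Φ → b` at infinity);
* the section `ψ = AttachReversal.hinv Φ` (= `invFunOn Φ H`) read through the API of helper file 1;
* the squeezed correspondence `T p = Φ (A_e (ψ p))` and its patch `T' p = if p = b then b else T p`
  (the pointwise form of the route's `Z₁ = T' ∘ R₁`, `AttachReversal.attZ`): `T'` is a continuous
  injection of `closure D` into itself, moves points by `< κ` when the squeeze is `κ`-close,
  fixes exactly `a ↦ a`, `b ↦ b`, and sends `closure D ∖ {a, b}` into `D`.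
-/

noncomputable section

open Set Filter Metric Complex Function
open scoped Topology
open UpperHalfPlane (upperHalfPlaneSet)
open Literature.Probability.RandomPlanarGeometry

namespace Summit.CriticalPhenomena.SAWScalingLimit.Theorems

namespace FaithfulAttach

open AttachReversal

variable {D : DobrushinDomain} {φ : ConformalEquiv upperHalfPlaneSet D.carrier} {e : ℝ}

/-! ### The angular squeeze: displacement and uniform smallness -/

/-- The defining formula of `AttachReversal.squeeze`, in the form consumed by the `sqz_*` lemmas. -/
theorem squeeze_spec (e : ℝ) : ∀ z : ℂ, squeeze e z =
    (‖z‖ : ℂ) * Complex.exp (Complex.I * ((e : ℂ) + (1 - 2 * (e : ℂ) / (Real.pi : ℂ)) * (arg z : ℂ))) :=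
  fun _ => rfl

/-- **The squeeze moves points little**: `‖A_e z - z‖ ≤ e ‖z‖` on the closed half-plane. -/
theorem norm_squeeze_sub_le (he0 : 0 ≤ e) {z : ℂ} (hz : 0 ≤ z.im) :
    ‖squeeze e z - z‖ ≤ e * ‖z‖ := by
  have hπ := Real.pi_pos
  have h0 : 0 ≤ arg z := arg_nonneg_iff.2 hz
  have h1 : arg z ≤ Real.pi := arg_le_pi z
  have hrepr : squeeze e z - z = (‖z‖ : ℂ) * (exp ((arg z : ℂ) * I) *
      (exp (I * ((e + (1 - 2 * e / Real.pi) * arg z - arg z : ℝ) : ℂ)) - 1)) := by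
    rw [mul_sub, mul_one, ← Complex.exp_add, squeeze_spec e z, sqz_exponent_eq]
    conv_lhs => arg 2; rw [← norm_mul_exp_arg_mul_I z]
    rw [← mul_sub]
    congr 2
    push_cast
    ring
  rw [hrepr, norm_mul, Complex.norm_real, norm_norm, mul_comm]
  refine mul_le_mul_of_nonneg_right ?_ (norm_nonneg _)
  rw [norm_mul, norm_exp_ofReal_mul_I, one_mul]
  refine Real.norm_exp_I_mul_ofReal_sub_one_le.trans ?_
  rw [Real.norm_eq_abs, show e + (1 - 2 * e / Real.pi) * arg z - arg z = e * (1 - 2 * arg z / Real.pi) by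
    field_simp; ring, abs_mul, abs_of_nonneg he0]
  refine mul_le_of_le_one_right he0 (abs_le.2 ⟨?_, ?_⟩)
  · have : 2 * arg z / Real.pi ≤ 2 := by
      rw [div_le_iff₀ hπ]
      linarith
    linarith
  · have : 0 ≤ 2 * arg z / Real.pi := by positivity
    linarith

/-- **Uniform smallness of the squeeze seen through `Φ`.** For every `κ > 0` there is
`e₀ ∈ (0, 1/2]` such that for every `0 < e ≤ e₀`, `dist (Φ (A_e z)) (Φ z) < κ` for all `z` in the
closed half-plane: far out both points are `κ/2`-close to `b` (`exists_norm_le_dist_bext_lt`), and on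
`H ∩ closedBall 0 M` the map `Φ` is uniformly continuous while `‖A_e z - z‖ ≤ e M`. -/
theorem exists_squeeze_close (hφ : D.IsChordalUniformizing φ) {κ : ℝ} (hκ : 0 < κ) :
    ∃ e₀ : ℝ, 0 < e₀ ∧ e₀ ≤ 1 / 2 ∧ ∀ e : ℝ, 0 < e → e ≤ e₀ →
      ∀ z : ℂ, 0 ≤ z.im → dist (φ.boundaryExtension (squeeze e z)) (φ.boundaryExtension z) < κ := by
  obtain ⟨M, hM, hfar⟩ := exists_norm_le_dist_bext_lt hφ (half_pos hκ)
  obtain ⟨η, hη, hunif⟩ := exists_unifCont_bext φ M hκ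
  refine ⟨min (1 / 2) (η / (2 * M)), lt_min (by norm_num) (by positivity), min_le_left _ _,
    fun e he0 hee₀ z hz => ?_⟩
  have he1 : e ≤ 1 / 2 := hee₀.trans (min_le_left _ _)
  have himA : 0 ≤ (squeeze e z).im := sqz_im_nonneg he0 he1 (squeeze_spec e) hz
  rcases le_or_gt M ‖z‖ with hzM | hzM
  · have h1 := hfar z hz hzM
    have h2 := hfar (squeeze e z) himA (by rwa [sqz_norm (squeeze_spec e)])
    calc dist (φ.boundaryExtension (squeeze e z)) (φ.boundaryExtension z)
        ≤ dist (φ.boundaryExtension (squeeze e z)) (D.pt 1) + dist (φ.boundaryExtension z) (D.pt 1) :=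
          dist_triangle_right _ _ _
      _ < κ / 2 + κ / 2 := add_lt_add h2 h1
      _ = κ := by ring
  · refine hunif (squeeze e z) z himA hz (by rw [sqz_norm (squeeze_spec e)]; exact hzM.le) hzM.le ?_
    rw [dist_eq_norm]
    calc ‖squeeze e z - z‖ ≤ e * ‖z‖ := norm_squeeze_sub_le he0.le hz
      _ ≤ η / (2 * M) * M := mul_le_mul (hee₀.trans (min_le_right _ _)) hzM.le (norm_nonneg _)
          (by positivity)
      _ = η / 2 := by field_simp
      _ < η := half_lt_self hη

/-! ### The section `ψ = hinv Φ` -/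

/-- `hinv Φ` is the section `invFunOn Φ {0 ≤ im}` of helper file 1. -/
theorem hinv_eq (Φ : ℂ → ℂ) : hinv Φ = invFunOn Φ {z : ℂ | 0 ≤ z.im} := rfl

/-- `ψ p ∈ H` and `Φ (ψ p) = p` for `p ∈ closure D ∖ {b}`. -/
theorem hinv_spec (hφ : D.IsChordalUniformizing φ) {p : ℂ} (hp : p ∈ closure D.carrier)
    (hpb : p ≠ D.pt 1) :
    0 ≤ (hinv φ.boundaryExtension p).im ∧ φ.boundaryExtension (hinv φ.boundaryExtension p) = p :=
  invFun_spec hφ hp hpb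

/-- `ψ (Φ z) = z` on the closed half-plane. -/
theorem hinv_bext (φ : ConformalEquiv upperHalfPlaneSet D.carrier) {z : ℂ} (hz : 0 ≤ z.im) :
    hinv φ.boundaryExtension (φ.boundaryExtension z) = z :=
  invFun_bext φ hz

/-- `ψ a = 0`. -/
theorem hinv_pt_zero (hφ : D.IsChordalUniformizing φ) : hinv φ.boundaryExtension (D.pt 0) = 0 :=
  invFun_pt_zero hφ

/-- `ψ p = 0 ↔ p = a` on `closure D ∖ {b}`. -/
theorem hinv_eq_zero_iff (hφ : D.IsChordalUniformizing φ) {p : ℂ} (hp : p ∈ closure D.carrier)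
    (hpb : p ≠ D.pt 1) : hinv φ.boundaryExtension p = 0 ↔ p = D.pt 0 :=
  invFun_eq_zero_iff hφ hp hpb

/-- Points of `D` are pulled back into the open half-plane. -/
theorem hinv_im_pos (hφ : D.IsChordalUniformizing φ) {p : ℂ} (hp : p ∈ D.carrier) :
    0 < (hinv φ.boundaryExtension p).im :=
  invFun_im_pos hφ hp

/-- `ψ` is continuous on `closure D ∖ {b}`. -/
theorem continuousOn_hinv (hφ : D.IsChordalUniformizing φ) :
    ContinuousOn (hinv φ.boundaryExtension) (closure D.carrier \ {D.pt 1}) :=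
  continuousOn_invFun hφ

/-- `‖ψ p‖ → ∞` as `p → b` in `closure D ∖ {b}`. -/
theorem exists_dist_lt_lt_norm_hinv (hφ : D.IsChordalUniformizing φ) (M : ℝ) :
    ∃ ρ : ℝ, 0 < ρ ∧ ∀ p ∈ closure D.carrier, p ≠ D.pt 1 → dist p (D.pt 1) < ρ →
      M < ‖hinv φ.boundaryExtension p‖ :=
  exists_dist_lt_le_norm_invFun hφ M

/-- `‖ψ p‖ → 0` as `p → a` in `closure D`. -/
theorem exists_dist_lt_norm_hinv_lt (hφ : D.IsChordalUniformizing φ) {ρ' : ℝ} (hρ' : 0 < ρ') :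
    ∃ ρ : ℝ, 0 < ρ ∧ ∀ p ∈ closure D.carrier, dist p (D.pt 0) < ρ →
      ‖hinv φ.boundaryExtension p‖ < ρ' :=
  exists_dist_lt_norm_invFun_lt hφ hρ'

/-! ### The squeezed boundary correspondence `T = Φ ∘ A_e ∘ ψ` and its patch `T'` -/

section Transport

variable (hφ : D.IsChordalUniformizing φ) (he0 : 0 < e) (he1 : e ≤ 1 / 2)

include hφ he0 he1

/-- `T p ∈ closure D` for `p ∈ closure D ∖ {b}`. -/
theorem transport_mem_closure {p : ℂ} (hp : p ∈ closure D.carrier) (hpb : p ≠ D.pt 1) :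
    φ.boundaryExtension (squeeze e (hinv φ.boundaryExtension p)) ∈ closure D.carrier :=
  bext_mem_closure φ (sqz_im_nonneg he0 he1 (squeeze_spec e) (hinv_spec hφ hp hpb).1)

/-- `T p = a ↔ p = a`. -/
theorem transport_eq_pt_zero_iff {p : ℂ} (hp : p ∈ closure D.carrier) (hpb : p ≠ D.pt 1) :
    φ.boundaryExtension (squeeze e (hinv φ.boundaryExtension p)) = D.pt 0 ↔ p = D.pt 0 := by
  rw [bext_eq_pt_zero_iff hφ (sqz_im_nonneg he0 he1 (squeeze_spec e) (hinv_spec hφ hp hpb).1),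
    sqz_eq_zero_iff (squeeze_spec e), hinv_eq_zero_iff hφ hp hpb]

/-- `T p ∈ D` unless `p = a`. -/
theorem transport_mem_carrier {p : ℂ} (hp : p ∈ closure D.carrier) (hpb : p ≠ D.pt 1)
    (hpa : p ≠ D.pt 0) :
    φ.boundaryExtension (squeeze e (hinv φ.boundaryExtension p)) ∈ D.carrier :=
  bext_mem_carrier φ (sqz_im_pos he0 he1 (squeeze_spec e) (hinv_spec hφ hp hpb).1
    fun h => hpa ((hinv_eq_zero_iff hφ hp hpb).1 h))

/-- `T p ≠ b`. -/
theorem transport_ne_pt_one {p : ℂ} (hp : p ∈ closure D.carrier) (hpb : p ≠ D.pt 1) :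
    φ.boundaryExtension (squeeze e (hinv φ.boundaryExtension p)) ≠ D.pt 1 :=
  bext_ne_pt_one hφ (sqz_im_nonneg he0 he1 (squeeze_spec e) (hinv_spec hφ hp hpb).1)

/-- `T` is injective on `closure D ∖ {b}`. -/
theorem transport_injOn :
    InjOn (fun p => φ.boundaryExtension (squeeze e (hinv φ.boundaryExtension p)))
      (closure D.carrier \ {D.pt 1}) := by
  intro p hp q hq h
  have hp' := hinv_spec hφ hp.1 hp.2
  have hq' := hinv_spec hφ hq.1 hq.2
  have h1 : squeeze e (hinv φ.boundaryExtension p) = squeeze e (hinv φ.boundaryExtension q) :=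
    bext_injOn φ (sqz_im_nonneg he0 he1 (squeeze_spec e) hp'.1)
      (sqz_im_nonneg he0 he1 (squeeze_spec e) hq'.1) h
  have h2 := sqz_injOn he0 he1 (squeeze_spec e) hp'.1 hq'.1 h1
  rw [← hp'.2, ← hq'.2, h2]

/-- `T` is continuous on `closure D ∖ {b}`. -/
theorem continuousOn_transport :
    ContinuousOn (fun p => φ.boundaryExtension (squeeze e (hinv φ.boundaryExtension p)))
      (closure D.carrier \ {D.pt 1}) := by
  have h1 : MapsTo (hinv φ.boundaryExtension) (closure D.carrier \ {D.pt 1}) {z : ℂ | 0 ≤ z.im} :=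
    fun p hp => (hinv_spec hφ hp.1 hp.2).1
  have h2 : MapsTo (squeeze e) {z : ℂ | 0 ≤ z.im} {z : ℂ | 0 ≤ z.im} := fun z hz =>
    sqz_im_nonneg he0 he1 (squeeze_spec e) hz
  exact ((continuousOn_boundaryExtension_im_nonneg φ).comp (sqz_continuousOn (squeeze_spec e)) h2).comp
    (continuousOn_hinv hφ) h1

/-- **The patched squeeze `T'` is continuous on `closure D`** (at `b`: points close to `b` have large
preimages, the squeeze preserves norms, and `Φ → b` at infinity). -/
theorem continuousOn_transport' :
    ContinuousOn (fun p => @ite ℂ (p = D.pt 1) (Classical.propDecidable _) (D.pt 1)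
      (φ.boundaryExtension (squeeze e (hinv φ.boundaryExtension p)))) (closure D.carrier) := by
  intro p hp
  by_cases hpb : p = D.pt 1
  · subst hpb
    rw [Metric.continuousWithinAt_iff]
    intro κ hκ
    obtain ⟨M, -, hfar⟩ := exists_norm_le_dist_bext_lt hφ hκ
    obtain ⟨ρ, hρ, hnear⟩ := exists_dist_lt_lt_norm_hinv hφ M
    refine ⟨ρ, hρ, fun q hq hdist => ?_⟩
    simp only [if_true]
    by_cases hqb : q = D.pt 1
    · rw [if_pos hqb, dist_self]
      exact hκ
    · rw [if_neg hqb]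
      have h1 := hnear q hq hqb hdist
      exact hfar _ (sqz_im_nonneg he0 he1 (squeeze_spec e) (hinv_spec hφ hq hqb).1)
        (by rw [sqz_norm (squeeze_spec e)]; exact h1.le)
  · have hmem : closure D.carrier \ {D.pt 1} ∈ 𝓝[closure D.carrier] p :=
      mem_nhdsWithin.2 ⟨{D.pt 1}ᶜ, isOpen_compl_singleton, hpb, fun q hq => ⟨hq.2, hq.1⟩⟩
    have hc : ContinuousWithinAt (fun p => φ.boundaryExtension
        (squeeze e (hinv φ.boundaryExtension p))) (closure D.carrier) p :=
      (continuousWithinAt_inter' hmem).1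
        ((continuousOn_transport hφ he0 he1 p ⟨hp, hpb⟩).mono inter_subset_right)
    refine hc.congr_of_eventuallyEq ?_ (by rw [if_neg hpb])
    filter_upwards [hmem] with q hq
    rw [if_neg (show q ≠ D.pt 1 from hq.2)]

omit he0 he1 in
/-- `T'` moves points of `closure D` by less than `κ`, if the squeeze is `κ`-close to the identity
through `Φ`. -/
theorem dist_transport'_lt {κ : ℝ} (hκ : 0 < κ)
    (hclose : ∀ z : ℂ, 0 ≤ z.im → dist (φ.boundaryExtension (squeeze e z)) (φ.boundaryExtension z) < κ)
    {p : ℂ} (hp : p ∈ closure D.carrier) :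
    dist (@ite ℂ (p = D.pt 1) (Classical.propDecidable _) (D.pt 1)
      (φ.boundaryExtension (squeeze e (hinv φ.boundaryExtension p)))) p < κ := by
  by_cases hpb : p = D.pt 1
  · rw [if_pos hpb, hpb, dist_self]
    exact hκ
  · rw [if_neg hpb]
    obtain ⟨him, heq⟩ := hinv_spec hφ hp hpb
    have := hclose _ him
    rwa [heq] at this

/-- `T' p = b ↔ p = b` on `closure D`. -/
theorem transport'_eq_pt_one_iff {p : ℂ} (hp : p ∈ closure D.carrier) :
    @ite ℂ (p = D.pt 1) (Classical.propDecidable _) (D.pt 1)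
      (φ.boundaryExtension (squeeze e (hinv φ.boundaryExtension p))) = D.pt 1 ↔ p = D.pt 1 := by
  by_cases hpb : p = D.pt 1
  · simp [hpb]
  · rw [if_neg hpb]
    exact ⟨fun h => absurd h (transport_ne_pt_one hφ he0 he1 hp hpb), fun h => absurd h hpb⟩

/-- `T' p = a ↔ p = a` on `closure D`. -/
theorem transport'_eq_pt_zero_iff {p : ℂ} (hp : p ∈ closure D.carrier) :
    @ite ℂ (p = D.pt 1) (Classical.propDecidable _) (D.pt 1)
      (φ.boundaryExtension (squeeze e (hinv φ.boundaryExtension p))) = D.pt 0 ↔ p = D.pt 0 := by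
  by_cases hpb : p = D.pt 1
  · rw [if_pos hpb, hpb]
  · rw [if_neg hpb]
    exact transport_eq_pt_zero_iff hφ he0 he1 hp hpb

/-- `T'` maps `closure D` into `D ∪ {a, b}`. -/
theorem transport'_mem {p : ℂ} (hp : p ∈ closure D.carrier) :
    @ite ℂ (p = D.pt 1) (Classical.propDecidable _) (D.pt 1)
      (φ.boundaryExtension (squeeze e (hinv φ.boundaryExtension p))) ∈ D.carrier ∨
    @ite ℂ (p = D.pt 1) (Classical.propDecidable _) (D.pt 1)
      (φ.boundaryExtension (squeeze e (hinv φ.boundaryExtension p))) = D.pt 0 ∨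
    @ite ℂ (p = D.pt 1) (Classical.propDecidable _) (D.pt 1)
      (φ.boundaryExtension (squeeze e (hinv φ.boundaryExtension p))) = D.pt 1 := by
  by_cases hpb : p = D.pt 1
  · exact Or.inr (Or.inr (by rw [if_pos hpb]))
  · by_cases hpa : p = D.pt 0
    · exact Or.inr (Or.inl ((transport'_eq_pt_zero_iff hφ he0 he1 hp).2 hpa))
    · rw [if_neg hpb]
      exact Or.inl (transport_mem_carrier hφ he0 he1 hp hpb hpa)

/-- `T'` maps `closure D` into `closure D`. -/
theorem transport'_mem_closure {p : ℂ} (hp : p ∈ closure D.carrier) :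
    @ite ℂ (p = D.pt 1) (Classical.propDecidable _) (D.pt 1)
      (φ.boundaryExtension (squeeze e (hinv φ.boundaryExtension p))) ∈ closure D.carrier := by
  by_cases hpb : p = D.pt 1
  · rw [if_pos hpb]
    exact pt_mem_closure D 1
  · rw [if_neg hpb]
    exact transport_mem_closure hφ he0 he1 hp hpb

/-- `T'` is injective on `closure D`. -/
theorem transport'_injOn :
    InjOn (fun p => @ite ℂ (p = D.pt 1) (Classical.propDecidable _) (D.pt 1)
      (φ.boundaryExtension (squeeze e (hinv φ.boundaryExtension p)))) (closure D.carrier) := by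
  intro p hp q hq h
  simp only at h
  by_cases hpb : p = D.pt 1
  · have : q = D.pt 1 := by
      rw [if_pos hpb] at h
      exact (transport'_eq_pt_one_iff hφ he0 he1 hq).1 h.symm
    rw [hpb, this]
  · by_cases hqb : q = D.pt 1
    · rw [if_pos hqb] at h
      exact absurd ((transport'_eq_pt_one_iff hφ he0 he1 hp).1 h) hpb
    · rw [if_neg hpb, if_neg hqb] at h
      exact transport_injOn hφ he0 he1 ⟨hp, hpb⟩ ⟨hq, hqb⟩ h

end Transport

end FaithfulAttach

end Summit.CriticalPhenomena.SAWScalingLimit.Theorems
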